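import Literature.NumberTheory.DiophantineGeometry.GenEllMechanismForPlaces
import Literature.NumberTheory.DiophantineGeometry.GenEllConjugateAvoidancePlaces
import Literature.NumberTheory.DiophantineGeometry.GenEllDePersistentPool
import Literature.NumberTheory.DiophantineGeometry.GenEllThm21
import Literature.NumberTheory.DiophantineGeometry.GenEllThm21SupportMonotone
import HarnessLib

/-!
# [GenEll] Theorem 2.1, (ii) ⇒ (i) for `(ℙ¹, [0]+[1]+[∞])` at EVERY finite set of primes `Σ` —
# the named fact `GenEll_thm21_primes` DISCHARGED

S. Mochizuki, *Arithmetic elliptic curves in general position*, Math. J. Okayama Univ. **52** (2010),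
Theorem 2.1, pp. 11–13 [cite: MochizukiGenEll2010, Thm 2.1 pp.11–13]: "Let `Σ` be a finite set of
prime numbers. … (ii) ⇒ (i)".  The tree's faithful transcription for the `ℙ¹ ∖ {0,1,∞}` case of (i)
is the named fact `GenEll.GenEll_thm21_primes` (`GenEllThm21.lean`, abc-iut-S-d2 repair of A-Sd2-F1;
FACT-LIST F-1336), consumed as a hypothesis by the campaign-S endpoint
`ABC_of_corollary22_primes` (Summits/ABC/IUTFork/GenEllAbcFinal) and its siblings.  This file PROVES
it, for every finite set of primes `Σ`, by the cell's number-field-only architecture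
(`GENELLTWO-P1ROUTE.md`, abc-iut-S6 and the w5 crew; the route item `GenEllTwo` is its `Σ = {2}`
instance):

1. WLOG `2 ∈ Σ`: statement (ii) is ANTITONE in `Σ` (a compactly bounded subset whose support contains
   `insert 2 Σ` has support containing `Σ`; `abcCompactlyBounded_of_subset`, `GenEllThm21SupportMonotone`),
   so (ii) at `Σ` gives (ii) at `Σ' := insert 2 Σ`.
2. `ε ↦ k ≥ 3` with `(2k+1)/(2k−2) < 1 + ε` (ramification index `e = 2k+1` of the cover `D_e → ℙ¹`).
3. A menu of `(|Σ'|+1)·d + 1` parameters `c_i ≠ 0` with pairwise coprime persistent polynomials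
   vanishing on the persistent sets in every field of characteristic `0`
   (`DeFamily.exists_persistent_polys_allFields`, w5-d065 lineage).
4. For each `c_i`: the mechanism of every configuration with separation at `{∞} ∪ Σ'`
   (`mechanismFor_places`, piece 2 — W7 at every `ℓ ∈ Σ'`, the annulus compactly bounded subset with
   support `{∞} ∪ Σ'`, the W5 conductor bound of w5-d045 with its 2-adic clause read at `2 ∈ Σ'`).
5. The MULTI-PLACE spine `vojtaIneq_univ_of_persistent_places` (w5-d075/w5-d081 lineage) over the
   place family `Λ := Σ'`: a configuration has `≤ d` entries at `∞` and at each `ℓ ∈ Σ'`, hence meets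
   at most `(|Σ'|+1)·d` of the pairwise disjoint persistent sets — pigeonhole.

* `GenEll_thm21_primes_holds : GenEll_thm21_primes` — [GenEll] Thm 2.1 (ii) ⇒ (i)|_{ℙ¹}, all `Σ`.
* `vojtaP1Deg_of_abcCompactlyBounded(_of_two_mem)` (the `Σ`-indexed interface; the WLOG step uses
  w5-d009's `abcCompactlyBounded_of_subset`), `vojtaP1Deg_iff_abcCompactlyBounded` ((i)|_{ℙ¹} ⟺ (ii) at `Σ`),
  `abc_of_abcCompactlyBounded_of_primes` ((ii) ⟹ abc, unconditional).

Theorems only.  Classical, refereed and outside the IUT dispute (Scholze–Stix 2018 §1.2); nothing here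
bears on [IUTchIII] Cor. 3.12.  HONEST FRAMING: this discharges the GenEll INPUT of the campaign-S
chain; the chain's other input ([IUTchIV] Cor. 2.2, from the disputed [IUTchIII] Cor. 3.12) is untouched.
-/

noncomputable section

open Polynomial
open Literature.NumberTheory.DiophantineGeometry

namespace Literature.NumberTheory.DiophantineGeometry.GenEll

/-- **[GenEll] Thm. 2.1, (ii) ⇒ (i)|_{ℙ¹}, for a finite set of primes `Σ` CONTAINING `2`**: statement
(ii) at `Σ` implies the uniform Vojta inequality in every degree `d ≥ 1` — menu of `(|Σ|+1)·d + 1`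
parameters with pairwise coprime persistent polynomials, the mechanisms with separation at `{∞} ∪ Σ`,
and the multi-place spine over `Λ := Σ`. [cite: MochizukiGenEll2010, Thm 2.1 pp.11–13] -/
theorem vojtaP1Deg_of_abcCompactlyBounded_of_two_mem {S : Finset ℕ} (hS : ∀ ℓ ∈ S, ℓ.Prime)
    (h2S : 2 ∈ S) (hii : ABCCompactlyBounded S) {d : ℕ} (hd : 0 < d) : VojtaP1Deg d := by
  classical
  intro ε hε
  -- `e = 2k+1` with `k ≥ 3` and `e/(e−3) < 1 + ε` (print, p. 12, constrains its `ε'` by the explicit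
  -- inequality `(1+ε')² ≤ 1+ε`; here the needed bound `e/(e−3) < 1+ε` is arranged directly)
  obtain ⟨k, hk, hke⟩ : ∃ k : ℕ, 3 ≤ k ∧
      ((2 * k + 1 : ℕ) : ℝ) / (((2 * k + 1 : ℕ) : ℝ) - 3) < 1 + ε := by
    obtain ⟨m, hm⟩ := exists_nat_gt (3 / (2 * ε))
    refine ⟨m + 3, by omega, ?_⟩
    have hpos : (0 : ℝ) < ((2 * (m + 3) + 1 : ℕ) : ℝ) - 3 := by push_cast; linarith
    rw [div_lt_iff₀ hpos]
    push_cast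
    have h1 : 3 < 2 * ε * (m : ℝ) := by
      have := (div_lt_iff₀ (by positivity : (0 : ℝ) < 2 * ε)).1 hm
      linarith
    nlinarith
  -- the place family `Λ := S`, `pr := (↑)`
  haveI hpr : ∀ l : (S : Set ℕ), Fact (l : ℕ).Prime := fun l => ⟨hS l l.2⟩
  -- the menu of `(|S|+1)·d + 1` parameters with pairwise coprime persistent polynomials
  obtain ⟨c, Pers, hc0, -, hP0, hcop, hroots⟩ :=
    DeFamily.exists_persistent_polys_allFields hk ((Fintype.card (S : Set ℕ) + 1) * d + 1)
  refine vojtaIneq_univ_of_persistent_places (Λ := (S : Set ℕ)) (fun l => (l : ℕ)) d Pers hP0 hcop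
    (by simp) ?_
  intro i q hq hqP
  obtain ⟨g, hgq, hg⟩ := mechanismFor_places hS h2S hii hd hε hk hke (hc0 i)
    (fun Ω _ _ a ha => hroots Ω i a ha) q hq hqP
  refine ⟨g, hgq, fun r hr => (hg r hr).mono (Set.inter_subset_inter_left _ fun P hP => ?_)⟩
  exact ⟨hP.1, fun ℓ hℓ _ => hP.2 ⟨ℓ, hℓ⟩⟩

/-- **[GenEll] Thm. 2.1, (ii) ⇒ (i)|_{ℙ¹}, for EVERY finite set of primes `Σ`** (`Σ`-indexed form):
WLOG `2 ∈ Σ` by antitonicity. [cite: MochizukiGenEll2010, Thm 2.1 pp.11–13] -/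
theorem vojtaP1Deg_of_abcCompactlyBounded {S : Finset ℕ} (hS : ∀ ℓ ∈ S, ℓ.Prime)
    (hii : ABCCompactlyBounded S) {d : ℕ} (hd : 0 < d) : VojtaP1Deg d :=
  vojtaP1Deg_of_abcCompactlyBounded_of_two_mem (S := insert 2 S)
    (fun ℓ hℓ => by
      rcases Finset.mem_insert.mp hℓ with rfl | h
      · exact Nat.prime_two
      · exact hS ℓ h)
    (Finset.mem_insert_self 2 S) (abcCompactlyBounded_of_subset (Finset.subset_insert 2 S) hii) hd

/-- **[GenEll] Thm. 2.1 for `(ℙ¹, [0]+[1]+[∞])`, (i) ⟺ (ii)**: for every finite set of primes `Σ`,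
statement (i)|_{ℙ¹} in every degree is EQUIVALENT to statement (ii) at `Σ` ((i) ⇒ (ii) is
`abcCompactlyBounded_of_vojtaP1Deg`, "immediate from the definitions"; (ii) ⇒ (i) is the content).
[cite: MochizukiGenEll2010, Thm 2.1 p.11] -/
theorem vojtaP1Deg_iff_abcCompactlyBounded {S : Finset ℕ} (hS : ∀ ℓ ∈ S, ℓ.Prime) :
    (∀ d : ℕ, 0 < d → VojtaP1Deg d) ↔ ABCCompactlyBounded S :=
  ⟨fun h => abcCompactlyBounded_of_vojtaP1Deg h S, fun h _ hd => vojtaP1Deg_of_abcCompactlyBounded hS h hd⟩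

/-- **NAMED FACT DISCHARGED — [GenEll] Theorem 2.1, direction (ii) ⇒ (i), with (i) specialised to
`X = ℙ¹_ℚ`, `D = [0]+[1]+[∞]`, for every finite set `Σ` of prime numbers** (`GenEll_thm21_primes`,
F-1336): kernel-proved by the number-field-only route (Kummer cover `D_e`, explicit noncritical
Belyi maps `ρ_T ∘ t_c`, Prop. 1.6/1.7 bookkeeping with defects, compactness of bounded-degree
conjugate configurations), no residual hypothesis. [cite: MochizukiGenEll2010, Thm 2.1 pp.11–13] -/
theorem GenEll_thm21_primes_holds : GenEll_thm21_primes :=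
  fun _ hS hii _ hd => vojtaP1Deg_of_abcCompactlyBounded hS hii hd

/-- **(ii) ⟹ abc, unconditionally**: for a finite set `Σ` of prime numbers, statement (ii) of
[GenEll] Thm. 2.1 for the `Σ`-supported compactly bounded subsets of `ℙ¹ ∖ {0,1,∞}` implies the abc
sentence (`GenEllThm21.abc_of_abcCompactlyBounded_primes` with its named-fact hypothesis discharged).
[cite: MochizukiGenEll2010, Thm 2.1 p.11] -/
theorem abc_of_abcCompactlyBounded_of_primes {S : Finset ℕ} (hS : ∀ p ∈ S, p.Prime)
    (h : ABCCompactlyBounded S) :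
    ∀ ε : ℝ, 0 < ε → ∃ C : ℝ, 0 < C ∧
      ∀ a b c : ℕ, IsABCTriple a b c → (c : ℝ) < C * ((rad a b c : ℕ) : ℝ) ^ (1 + ε) :=
  abc_of_abcCompactlyBounded_primes GenEll_thm21_primes_holds hS h

end Literature.NumberTheory.DiophantineGeometry.GenEll

end
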